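import Summits.ValiantsHypothesis.ValiantsHypothesis.Theorems.TwoProducts.RankThreeAffineToricWronskianDepth

/-!
# Toric Wronskians of monomials, part 7: class ranks, Newton coefficients and the class-triangular factor (the scalar algebra of W4b)

Sequel of ✓ `…ToricWronskianDepth` (W4a, p721689: `toricWDefect`, `toricW_support_layer`, `toricW_isDomTop_layer`).  This file is PURE SCALAR ALGEBRA
over `ℂ` for the closed form of the depth-`d` layer coefficient (the sequel `…ToricWronskianDepthForm`, val-idea-crit-8 g6 #118 (L1) / (W4b)):
no polynomials `W` appear here.  For class data `b : Fin K → Expo` (column `i` lies in the class = fibre `b i`):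
§1 ★ `toricWRank b i = ℓ_i = #{j < i : b j = b i}` (the rank of `i` in its class, index order): strictly increasing along a class
(`toricWRank_lt_of_lt`), injective on classes (`toricWRank_injOn`), `ℓ_i < r_i` (`toricWRank_lt_card`), the ranks of a class (resp. of its part
below `i`) are exactly `range r` (resp. `range ℓ_i`) (`toricWRank_image`, `toricWRank_image_lt`), and ★ `sum_toricWRank`: `Σ_i ℓ_i = toricWDefect b`.
§2 ★ `toricWNewt y a s` = the NEWTON COEFFICIENTS `h_{a−s}(y_0,…,y_s)` of `x^a` along a node sequence `y` (recursion
`newt (a+1) s = y_s·newt a s + newt a (s−1)`), vanishing above the diagonal, `1` on it, local in `y_{≤ s}` (`toricWNewt_congr`), and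
★★ `toricWNewt_expand`: NEWTON'S IDENTITY `x^a = Σ_{s≤a} newt y a s · Π_{t<s}(x − y_t)`.
§3 `toricWNodes b x β0 t` = the node sequence of a class (`= x_j` at `t = ℓ_j`, `toricWNodes_rank`) and ★ the CLASS-TRIANGULAR FACTOR
`toricWTri b x`: `T_{i',i} = [b i' = b i]·Π_{j<i', j∼i'}(x_i − x_j)` — the Newton basis polynomial of the class of `i'` of degree `ℓ_{i'}` evaluated at `x_i`;
UPPER TRIANGULAR in the native order of `Fin K` (`toricWTri_eq_zero_of_lt`), so ★ `det_toricWTri`: `det T = Π_i Π_{j<i, j∼i}(x_i − x_j)` (the in-class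
Vandermondes); ★★ `toricW_pow_eq_sum_newt_tri` / `toricW_vandermonde_transpose_eq`: `Vandermonde(x)ᵀ = H′·T`, `H′_{a,i'} = newt(class nodes)_{a,ℓ_{i'}}`.
§4 ★★ `det_toricWNewt`: for `β` constant on the classes and `γ ≠ 0`, with `z_i = β_i + ℓ_iγ` (the nodes of a class form the arithmetic progression
`β_c, β_c+γ, …`): `det[newt(β_{i'} + ·γ)_{a,ℓ_{i'}}]_{a,i'} = Π_i Π_{j<i, j≁i}(z_i − z_j)` — the Vandermonde of `z` with its non-zero in-class factors
`(ℓ_i − ℓ_j)γ` cancelled against `det T`.  (In the sequel: `H′` along the `n`-nodes reduces the class matrix of the Wronskian, `H′` along the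
`z`-nodes evaluates the leading scalars.)  HONEST LABEL: bookkeeping for the exact engine on the OPEN rung 3-AFF (side ladder, crux
`stmt-ValiantsHypothesis-5906` `TwoProducts`); (TW-flag, poly) at MERGES, `OLMLaw`, `RankThreeAffineLaw(Exp)`, `TwoProducts`, PCB, `ResidualLawV25`
UNMOVED; 0 summit distance; VP ≠ VNP is NOT proved.  `--supports stmt-ValiantsHypothesis-5906 --as helper` (val-port-4 g6; critic of record
val-idea-crit-8 g6).  New defs (data, with parameters): `toricWRank`, `toricWNewt`, `toricWNodes`, `toricWTri`; no instances, no notation, no named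
facts. [folklore]
-/

noncomputable section
set_option linter.dupNamespace false

namespace Summit.ValiantsHypothesis.ValiantsHypothesis.Theorems.TwoProducts.RankTwoJacobian

open scoped BigOperators
open MvPolynomial

section TowerKernel
open scoped Classical

/-! ### §1 Ranks inside the classes -/

/-- the RANK of column `i` inside its class (fibre of the base map `b`), in index order: `ℓ_i = #{j < i : b j = b i}`. [folklore] -/
def toricWRank {K : ℕ} (b : Fin K → Expo) (i : Fin K) : ℕ :=
  ((Finset.univ : Finset (Fin K)).filter fun j => j < i ∧ b j = b i).card

/-- ranks increase along a class. [folklore] -/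
theorem toricWRank_lt_of_lt {K : ℕ} (b : Fin K → Expo) {i j : Fin K} (hji : j < i) (hb : b j = b i) :
    toricWRank b j < toricWRank b i := by
  unfold toricWRank
  refine Finset.card_lt_card (Finset.ssubset_iff_of_subset (fun x hx => ?_) |>.mpr ⟨j, ?_, ?_⟩)
  · obtain ⟨h1, h2⟩ := (Finset.mem_filter.mp hx).2
    exact Finset.mem_filter.mpr ⟨Finset.mem_univ _, h1.trans hji, h2.trans hb⟩
  · exact Finset.mem_filter.mpr ⟨Finset.mem_univ _, hji, hb⟩
  · intro h; exact lt_irrefl _ (Finset.mem_filter.mp h).2.1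

/-- the rank is injective on each class. [folklore] -/
theorem toricWRank_injOn {K : ℕ} (b : Fin K → Expo) {i j : Fin K} (hb : b j = b i) (h : toricWRank b j = toricWRank b i) : j = i := by
  rcases lt_trichotomy j i with hlt | heq | hgt
  · exact absurd h (ne_of_lt (toricWRank_lt_of_lt b hlt hb))
  · exact heq
  · exact absurd h.symm (ne_of_lt (toricWRank_lt_of_lt b hgt hb.symm))

/-- `ℓ_i < r_i`, the size of the class. [folklore] -/
theorem toricWRank_lt_card {K : ℕ} (b : Fin K → Expo) (i : Fin K) :
    toricWRank b i < ((Finset.univ : Finset (Fin K)).filter fun j => b j = b i).card := by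
  unfold toricWRank
  refine Finset.card_lt_card (Finset.ssubset_iff_of_subset (fun x hx => ?_) |>.mpr ⟨i, ?_, ?_⟩)
  · exact Finset.mem_filter.mpr ⟨Finset.mem_univ _, (Finset.mem_filter.mp hx).2.2⟩
  · exact Finset.mem_filter.mpr ⟨Finset.mem_univ _, rfl⟩
  · intro h; exact lt_irrefl _ (Finset.mem_filter.mp h).2.1

/-- the ranks of the class elements below `i` are exactly `0, …, ℓ_i − 1`. [folklore] -/
theorem toricWRank_image_lt {K : ℕ} (b : Fin K → Expo) (i : Fin K) :
    ((Finset.univ : Finset (Fin K)).filter fun j => j < i ∧ b j = b i).image (toricWRank b) = Finset.range (toricWRank b i) := by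
  apply Finset.eq_of_subset_of_card_le
  · intro s hs
    obtain ⟨j, hj, rfl⟩ := Finset.mem_image.mp hs
    obtain ⟨h1, h2⟩ := (Finset.mem_filter.mp hj).2
    exact Finset.mem_range.mpr (toricWRank_lt_of_lt b h1 h2)
  · rw [Finset.card_range, Finset.card_image_of_injOn fun j hj j' hj' h =>
      toricWRank_injOn b (((Finset.mem_filter.mp hj).2.2).trans ((Finset.mem_filter.mp hj').2.2).symm) h]
    rfl

/-- the ranks of a whole class are exactly `0, …, r − 1`. [folklore] -/
theorem toricWRank_image {K : ℕ} (b : Fin K → Expo) (i : Fin K) :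
    ((Finset.univ : Finset (Fin K)).filter fun j => b j = b i).image (toricWRank b) =
      Finset.range ((Finset.univ : Finset (Fin K)).filter fun j => b j = b i).card := by
  apply Finset.eq_of_subset_of_card_le
  · intro s hs
    obtain ⟨j, hj, rfl⟩ := Finset.mem_image.mp hs
    have hbj : b j = b i := (Finset.mem_filter.mp hj).2
    have h := toricWRank_lt_card b j
    simp_rw [hbj] at h
    exact Finset.mem_range.mpr h
  · rw [Finset.card_range, Finset.card_image_of_injOn fun j hj j' hj' h =>
      toricWRank_injOn b (((Finset.mem_filter.mp hj).2).trans ((Finset.mem_filter.mp hj').2).symm) h]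

/-- `Σ_i ℓ_i = d` (the defect counts the pairs `j < i` of one class). [folklore] -/
theorem sum_toricWRank {K : ℕ} (b : Fin K → Expo) : ∑ i, toricWRank b i = toricWDefect b := by
  unfold toricWRank toricWDefect
  rw [Finset.card_filter, Fintype.sum_prod_type_right]
  refine Finset.sum_congr rfl fun i _ => ?_
  rw [Finset.card_filter]

/-! ### §2 Newton coefficients of `x^a` along a node sequence -/

/-- NEWTON COEFFICIENTS of `x^a` along the node sequence `y`: `newt y a s = h_{a−s}(y_0, …, y_s)` (complete homogeneous), defined by
`newt y 0 s = [s = 0]`, `newt y (a+1) s = y_s · newt y a s + newt y a (s−1)`. [folklore] -/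
def toricWNewt (y : ℕ → ℂ) : ℕ → ℕ → ℂ
  | 0, s => if s = 0 then 1 else 0
  | a + 1, s => y s * toricWNewt y a s + (if s = 0 then 0 else toricWNewt y a (s - 1))

/-- `newt y a s = 0` for `s > a`. [folklore] -/
theorem toricWNewt_eq_zero (y : ℕ → ℂ) : ∀ a s : ℕ, a < s → toricWNewt y a s = 0
  | 0, s, h => by have hs : s ≠ 0 := by omega
                  simp [toricWNewt, hs]
  | a + 1, s, h => by
    have h1 := toricWNewt_eq_zero y a s (by omega)
    have h2 := toricWNewt_eq_zero y a (s - 1) (by omega)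
    simp only [toricWNewt, h1, h2, mul_zero, zero_add, if_neg (by omega : s ≠ 0)]

/-- `newt y a a = 1`. [folklore] -/
theorem toricWNewt_diag (y : ℕ → ℂ) : ∀ a : ℕ, toricWNewt y a a = 1
  | 0 => by simp [toricWNewt]
  | a + 1 => by
    simp only [toricWNewt, toricWNewt_eq_zero y a (a + 1) (by omega), mul_zero, zero_add, if_neg (Nat.succ_ne_zero a),
      Nat.add_sub_cancel, toricWNewt_diag y a]

/-- LOCALITY: `newt y a s` only depends on `y_0, …, y_s`. [folklore] -/
theorem toricWNewt_congr {y y' : ℕ → ℂ} : ∀ (a s : ℕ), (∀ t, t ≤ s → y t = y' t) → toricWNewt y a s = toricWNewt y' a s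
  | 0, s, _ => by simp [toricWNewt]
  | a + 1, s, h => by
    simp only [toricWNewt]
    rw [h s le_rfl, toricWNewt_congr a s h]
    by_cases hs : s = 0
    · rw [if_pos hs, if_pos hs]
    · rw [if_neg hs, if_neg hs, toricWNewt_congr a (s - 1) fun t ht => h t (by omega)]

/-- ★ NEWTON'S IDENTITY: `x^a = Σ_{s ≤ a} newt y a s · Π_{t<s} (x − y_t)` for every node sequence `y`. [folklore] -/
theorem toricWNewt_expand (y : ℕ → ℂ) (x : ℂ) : ∀ a : ℕ,
    x ^ a = ∑ s ∈ Finset.range (a + 1), toricWNewt y a s * ∏ t ∈ Finset.range s, (x - y t)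
  | 0 => by simp [toricWNewt]
  | a + 1 => by
    rw [pow_succ, toricWNewt_expand y x a, Finset.sum_mul]
    -- expand the recursion on the right
    have hsplit : ∑ s ∈ Finset.range (a + 2), toricWNewt y (a + 1) s * ∏ t ∈ Finset.range s, (x - y t) =
        ∑ s ∈ Finset.range (a + 2), y s * toricWNewt y a s * ∏ t ∈ Finset.range s, (x - y t) +
        ∑ s ∈ Finset.range (a + 2), (if s = 0 then 0 else toricWNewt y a (s - 1)) * ∏ t ∈ Finset.range s, (x - y t) := by
      rw [← Finset.sum_add_distrib]
      refine Finset.sum_congr rfl fun s _ => ?_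
      simp only [toricWNewt]; ring
    rw [hsplit]
    -- first sum: the `s = a+1` term vanishes
    have hA : ∑ s ∈ Finset.range (a + 2), y s * toricWNewt y a s * ∏ t ∈ Finset.range s, (x - y t) =
        ∑ s ∈ Finset.range (a + 1), y s * toricWNewt y a s * ∏ t ∈ Finset.range s, (x - y t) := by
      rw [Finset.sum_range_succ, toricWNewt_eq_zero y a (a + 1) (by omega), mul_zero, zero_mul, add_zero]
    -- second sum: shift
    have hB : ∑ s ∈ Finset.range (a + 2), (if s = 0 then 0 else toricWNewt y a (s - 1)) * ∏ t ∈ Finset.range s, (x - y t) =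
        ∑ s ∈ Finset.range (a + 1), toricWNewt y a s * ((∏ t ∈ Finset.range s, (x - y t)) * (x - y s)) := by
      rw [Finset.sum_range_succ']
      simp only [Nat.succ_ne_zero, ite_false, ite_true, zero_mul, add_zero, Nat.add_sub_cancel, Finset.prod_range_succ]
    rw [hA, hB, ← Finset.sum_add_distrib]
    refine Finset.sum_congr rfl fun s _ => ?_
    ring

/-! ### §3 The node sequence of a class and the class-triangular factor -/

/-- the NODE SEQUENCE of the class with base value `β0`: `nodes b x β0 t = x_j` for the unique `j` with `b j = β0`, `ℓ_j = t` (`0` if none). [folklore] -/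
def toricWNodes {K : ℕ} (b : Fin K → Expo) (x : Fin K → ℂ) (β0 : Expo) (t : ℕ) : ℂ :=
  ∑ j ∈ (Finset.univ : Finset (Fin K)).filter (fun j => b j = β0 ∧ toricWRank b j = t), x j

/-- `nodes b x (b j) ℓ_j = x_j`. [folklore] -/
theorem toricWNodes_rank {K : ℕ} (b : Fin K → Expo) (x : Fin K → ℂ) (j : Fin K) : toricWNodes b x (b j) (toricWRank b j) = x j := by
  unfold toricWNodes
  rw [(Finset.eq_singleton_iff_unique_mem.mpr ⟨Finset.mem_filter.mpr ⟨Finset.mem_univ _, rfl, rfl⟩,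
    fun j' hj' => toricWRank_injOn b (Finset.mem_filter.mp hj').2.1 (Finset.mem_filter.mp hj').2.2⟩ :
    ((Finset.univ : Finset (Fin K)).filter fun j' => b j' = b j ∧ toricWRank b j' = toricWRank b j) = {j}),
    Finset.sum_singleton]

/-- the CLASS-TRIANGULAR factor: `T_{i',i} = [b i' = b i] · Π_{j<i', b j = b i'} (x_i − x_j)` — the Newton basis polynomial of the class of `i'` of degree
`ℓ_{i'}`, evaluated at `x_i`.  It is UPPER TRIANGULAR in the native order of `Fin K`. [folklore] -/
def toricWTri {K : ℕ} (b : Fin K → Expo) (x : Fin K → ℂ) : Matrix (Fin K) (Fin K) ℂ :=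
  Matrix.of fun i' i => if b i' = b i then ∏ j ∈ (Finset.univ : Finset (Fin K)).filter (fun j => j < i' ∧ b j = b i'), (x i - x j) else 0

/-- below the diagonal `T` vanishes (the factor `j = i` occurs). [folklore] -/
theorem toricWTri_eq_zero_of_lt {K : ℕ} (b : Fin K → Expo) (x : Fin K → ℂ) {i' i : Fin K} (h : i < i') : toricWTri b x i' i = 0 := by
  unfold toricWTri
  rw [Matrix.of_apply]
  by_cases hb : b i' = b i
  · rw [if_pos hb]
    exact Finset.prod_eq_zero (Finset.mem_filter.mpr ⟨Finset.mem_univ _, h, hb.symm⟩) (sub_self _)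
  · rw [if_neg hb]

/-- ★ `det T = Π_i Π_{j<i, j∼i} (x_i − x_j)` (the within-class Vandermonde products). [folklore] -/
theorem det_toricWTri {K : ℕ} (b : Fin K → Expo) (x : Fin K → ℂ) :
    (toricWTri b x).det = ∏ i : Fin K, ∏ j ∈ (Finset.univ : Finset (Fin K)).filter (fun j => j < i ∧ b j = b i), (x i - x j) := by
  have hT : (toricWTri b x).BlockTriangular id := fun i j hij => toricWTri_eq_zero_of_lt b x hij
  rw [Matrix.det_of_upperTriangular hT]
  refine Finset.prod_congr rfl fun i _ => ?_
  unfold toricWTri; rw [Matrix.of_apply, if_pos rfl]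

/-- the Newton basis product of the class of `i'` at rank `ℓ_{i'}`, evaluated at `x_i`, is the `T`-entry product. [folklore] -/
theorem toricWTri_prod_eq {K : ℕ} (b : Fin K → Expo) (x : Fin K → ℂ) (i' i : Fin K) :
    ∏ t ∈ Finset.range (toricWRank b i'), (x i - toricWNodes b x (b i') t) =
      ∏ j ∈ (Finset.univ : Finset (Fin K)).filter (fun j => j < i' ∧ b j = b i'), (x i - x j) := by
  rw [← toricWRank_image_lt, Finset.prod_image fun j hj j' hj' h =>
    toricWRank_injOn b (((Finset.mem_filter.mp hj).2.2).trans ((Finset.mem_filter.mp hj').2.2).symm) h]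
  refine Finset.prod_congr rfl fun j hj => ?_
  rw [← (Finset.mem_filter.mp hj).2.2, toricWNodes_rank]

/-- ★★ **VANDERMONDEᵀ = NEWTON · CLASS-TRIANGULAR:** `x_i^a = Σ_{i'} newt (nodes of the class of i') a ℓ_{i'} · T_{i',i}`. [folklore] -/
theorem toricW_pow_eq_sum_newt_tri {K : ℕ} (b : Fin K → Expo) (x : Fin K → ℂ) (i : Fin K) (a : ℕ) :
    x i ^ a = ∑ i' : Fin K, toricWNewt (toricWNodes b x (b i')) a (toricWRank b i') * toricWTri b x i' i := by
  set C : Finset (Fin K) := Finset.univ.filter fun j => b j = b i with hC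
  set y : ℕ → ℂ := toricWNodes b x (b i) with hy
  set g : ℕ → ℂ := fun s => toricWNewt y a s * ∏ t ∈ Finset.range s, (x i - y t) with hg
  -- the right-hand side lives on the class of `i`
  have hR : ∑ i' : Fin K, toricWNewt (toricWNodes b x (b i')) a (toricWRank b i') * toricWTri b x i' i =
      ∑ i' ∈ C, g (toricWRank b i') := by
    rw [← Finset.sum_filter_add_sum_filter_not Finset.univ (fun j => b j = b i), ← hC]
    have h0 : ∑ i' ∈ Finset.univ.filter (fun j => ¬ b j = b i),
        toricWNewt (toricWNodes b x (b i')) a (toricWRank b i') * toricWTri b x i' i = 0 := by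
      refine Finset.sum_eq_zero fun i' hi' => ?_
      unfold toricWTri; rw [Matrix.of_apply, if_neg (Finset.mem_filter.mp hi').2, mul_zero]
    rw [h0, add_zero]
    refine Finset.sum_congr rfl fun i' hi' => ?_
    have hb : b i' = b i := (Finset.mem_filter.mp hi').2
    rw [hg]; simp only
    unfold toricWTri; rw [Matrix.of_apply, if_pos hb, ← toricWTri_prod_eq, hb]
  -- reindex the class by its ranks
  have hR' : ∑ i' ∈ C, g (toricWRank b i') = ∑ s ∈ Finset.range C.card, g s := by
    rw [hC, ← toricWRank_image, Finset.sum_image fun j hj j' hj' h =>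
      toricWRank_injOn b (((Finset.mem_filter.mp hj).2).trans ((Finset.mem_filter.mp hj').2).symm) h]
  -- both index ranges can be enlarged to their union: the extra terms vanish
  have hi : i ∈ C := Finset.mem_filter.mpr ⟨Finset.mem_univ _, rfl⟩
  have hzero1 : ∀ s, C.card ≤ s → g s = 0 := by
    intro s hs
    rw [hg]; simp only
    refine mul_eq_zero_of_right _ (Finset.prod_eq_zero (Finset.mem_range.mpr (lt_of_lt_of_le (toricWRank_lt_card b i) hs)) ?_)
    rw [hy, toricWNodes_rank, sub_self]
  have hzero2 : ∀ s, a < s → g s = 0 := fun s hs => by rw [hg]; simp only; rw [toricWNewt_eq_zero y a s hs, zero_mul]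
  rw [toricWNewt_expand y (x i) a, hR, hR']
  rw [Finset.sum_subset (Finset.subset_union_left : Finset.range (a + 1) ⊆ Finset.range (a + 1) ∪ Finset.range C.card)
      fun s hs hns => hzero2 s (by rw [Finset.mem_range] at hns; omega),
    Finset.sum_subset (Finset.subset_union_right : Finset.range C.card ⊆ Finset.range (a + 1) ∪ Finset.range C.card)
      fun s hs hns => hzero1 s (by rw [Finset.mem_range] at hns; omega)]

/-- matrix form: `Vandermonde(x)ᵀ = H' · T` with `H'_{a,i'} = newt (nodes of the class of i') a ℓ_{i'}`. [folklore] -/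
theorem toricW_vandermonde_transpose_eq {K : ℕ} (b : Fin K → Expo) (x : Fin K → ℂ) :
    (Matrix.vandermonde x).transpose =
      (Matrix.of fun (a i' : Fin K) => toricWNewt (toricWNodes b x (b i')) (a : ℕ) (toricWRank b i')) * toricWTri b x := by
  ext a i
  rw [Matrix.transpose_apply, Matrix.vandermonde_apply, Matrix.mul_apply, toricW_pow_eq_sum_newt_tri b x i a]
  rfl

/-! ### §4 The cross-class product: `det` of the Newton matrix along the arithmetic progressions `β_c + ℓγ` -/

/-- ★★ **THE NEWTON DETERMINANT.** For `β` constant on the classes and `γ ≠ 0`, with `z_i = β_i + ℓ_i γ`: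
`det [newt (β_{i'} + ·γ) a ℓ_{i'}]_{a,i'} = Π_i Π_{j<i, j≁i} (z_i − z_j)` — the Vandermonde of `z` with its (non-zero) within-class factors
`(ℓ_i − ℓ_j)γ` divided out. [folklore] -/
theorem det_toricWNewt {K : ℕ} (b : Fin K → Expo) (β : Fin K → ℂ) (hβ : ∀ i j, b j = b i → β j = β i) {γ : ℂ} (hγ : γ ≠ 0) :
    (Matrix.of fun (a i' : Fin K) => toricWNewt (fun t => β i' + (t : ℂ) * γ) (a : ℕ) (toricWRank b i')).det =
      ∏ i : Fin K, ∏ j ∈ (Finset.univ : Finset (Fin K)).filter (fun j => j < i ∧ b j ≠ b i),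
        ((β i + (toricWRank b i : ℂ) * γ) - (β j + (toricWRank b j : ℂ) * γ)) := by
  set z : Fin K → ℂ := fun i => β i + (toricWRank b i : ℂ) * γ with hz
  -- the Newton matrix along the true node sequences equals the displayed one (locality + constancy of β on classes)
  have hH : (Matrix.of fun (a i' : Fin K) => toricWNewt (toricWNodes b z (b i')) (a : ℕ) (toricWRank b i')) =
      Matrix.of fun (a i' : Fin K) => toricWNewt (fun t => β i' + (t : ℂ) * γ) (a : ℕ) (toricWRank b i') := by
    ext a i'
    rw [Matrix.of_apply, Matrix.of_apply]
    refine toricWNewt_congr _ _ fun t ht => ?_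
    -- the class element of rank t
    have hmem : t ∈ ((Finset.univ : Finset (Fin K)).filter fun j => b j = b i').image (toricWRank b) := by
      rw [toricWRank_image]; exact Finset.mem_range.mpr (lt_of_le_of_lt ht (toricWRank_lt_card b i'))
    obtain ⟨j, hj, rfl⟩ := Finset.mem_image.mp hmem
    have hbj : b j = b i' := (Finset.mem_filter.mp hj).2
    rw [← hbj, toricWNodes_rank, hz]; simp only; rw [hβ i' j hbj]
  -- det Vᵀ = det H' · det T
  have hdet := congrArg Matrix.det (toricW_vandermonde_transpose_eq b z)
  rw [Matrix.det_transpose, Matrix.det_mul, hH, det_toricWTri, Matrix.det_vandermonde] at hdet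
  -- split the Vandermonde product into same-class and cross-class pairs
  have hV : ∏ i : Fin K, ∏ j ∈ Finset.Ioi i, (z j - z i) =
      (∏ i : Fin K, ∏ j ∈ (Finset.univ : Finset (Fin K)).filter (fun j => j < i ∧ b j = b i), (z i - z j)) *
        ∏ i : Fin K, ∏ j ∈ (Finset.univ : Finset (Fin K)).filter (fun j => j < i ∧ b j ≠ b i), (z i - z j) := by
    rw [Finset.prod_comm' (s := Finset.univ) (t := fun i => Finset.Ioi i) (t' := Finset.univ) (s' := fun j => Finset.Iio j)
      (fun a c => by simp), ← Finset.prod_mul_distrib]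
    refine Finset.prod_congr rfl fun i _ => ?_
    rw [← Finset.prod_filter_mul_prod_filter_not (Finset.Iio i) (fun j => b j = b i)]
    congr 1
    · refine Finset.prod_congr (by ext j; simp [Finset.mem_Iio]) fun _ _ => rfl
    · refine Finset.prod_congr (by ext j; simp [Finset.mem_Iio]) fun _ _ => rfl
  rw [hV, mul_comm] at hdet
  -- cancel the (non-zero) within-class factor
  have hne : (∏ i : Fin K, ∏ j ∈ (Finset.univ : Finset (Fin K)).filter (fun j => j < i ∧ b j = b i), (z i - z j)) ≠ 0 := by
    refine Finset.prod_ne_zero_iff.mpr fun i _ => Finset.prod_ne_zero_iff.mpr fun j hj => ?_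
    obtain ⟨h1, h2⟩ := (Finset.mem_filter.mp hj).2
    rw [hz]; simp only; rw [hβ i j h2]
    have hlt : (toricWRank b j : ℂ) ≠ toricWRank b i := by exact_mod_cast (ne_of_lt (toricWRank_lt_of_lt b h1 h2))
    intro h0
    apply hlt
    have : ((toricWRank b i : ℂ) - toricWRank b j) * γ = 0 := by linear_combination h0
    rcases mul_eq_zero.mp this with h | h
    · exact (sub_eq_zero.mp h).symm
    · exact absurd h hγ
  exact mul_right_cancel₀ hne hdet.symm

end TowerKernel

end Summit.ValiantsHypothesis.ValiantsHypothesis.Theorems.TwoProducts.RankTwoJacobian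

end
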